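import Literature.GroupTheory.CombinatorialGroupTheory.QuadraticWordsVertexDefs
import Literature.GroupTheory.CombinatorialGroupTheory.PermutationCycleSurgery
import Mathlib.GroupTheory.PresentedGroup
import HarnessLib

/-!
# Killing generators of a presentation: Tietze bookkeeping for one-face systems

Topic `Literature/GroupTheory/CombinatorialGroupTheory`.  Two Tietze steps used at the end of the
Reidemeister–Schreier computation of finite-index subgroups of surface groups (ZVC 4.14.22,
proof; Lyndon–Schupp II.2 Tietze transformations):

* `normalClosure_union_of_eq_normalClosure_killHom` — adding the generators `x_i` (`i ∈ S`) as
  relators, every other relator may be replaced by the word with the letters `x_i^{±1}` DELETED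
  (`killHom`, `QuadraticWords.lean`): the two relator sets have the same normal closure;
* `nonempty_presentedGroup_kill_equiv` — a presentation `⟨ι ∣ W, (x_i)_{i ∈ S}⟩` whose word
  `W` does not involve the killed generators is the one-relator presentation `⟨ι ∖ S ∣ W⟩` on the
  remaining generators (`restrictWord`);
* `restrictWord` bookkeeping: `Nodup`, `Closed`, `IsQuadratic`, and `VertexTransitive` pass to
  the restricted word (`vertexTransitive_restrictWord`), through `formPerm_map_of_injective`.

## References

* H. Zieschang, E. Vogt, H.-D. Coldewey, *Surfaces and Planar Discontinuous Groups*, LNM 835,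
  Springer 1980, 2.2.5 (Tietze), 4.14.22. [ZieschangVogtColdewey1980]
-/

namespace Literature.GroupTheory.CombinatorialGroupTheory

open List Equiv Equiv.Perm

variable {ι : Type*} [DecidableEq ι]

/-! ### Deleting killed letters from the other relators -/

omit [DecidableEq ι] in
/-- Modulo the normal closure of the killed generators, a word equals the word with the killed
letters deleted. [cite: ZieschangVogtColdewey1980, 2.2.5] -/
theorem inv_mul_killHom_mem (S : Set ι) [DecidablePred (· ∈ S)] (x : FreeGroup ι) :
    x⁻¹ * killHom (· ∈ S) x ∈ Subgroup.normalClosure (FreeGroup.of '' S) := by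
  set N := Subgroup.normalClosure (FreeGroup.of '' S) with hN
  have key : (QuotientGroup.mk' N).comp (killHom (· ∈ S)) = QuotientGroup.mk' N := by
    refine FreeGroup.ext_hom _ _ fun i => ?_
    by_cases hi : i ∈ S
    · rw [MonoidHom.comp_apply]
      have h1 : killHom (· ∈ S) (FreeGroup.of i) = 1 := by simp [killHom, hi]
      rw [h1, map_one, eq_comm, QuotientGroup.mk'_apply, QuotientGroup.eq_one_iff]
      exact Subgroup.subset_normalClosure ⟨i, hi, rfl⟩
    · rw [MonoidHom.comp_apply]
      simp [killHom, hi]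
  have := DFunLike.congr_fun key x
  rw [MonoidHom.comp_apply, QuotientGroup.mk'_apply, QuotientGroup.mk'_apply, eq_comm, QuotientGroup.eq] at this
  exact this

omit [DecidableEq ι] in
/-- **Killed generators may be deleted from the other relators**: the relator sets
`R ∪ {x_i : i ∈ S}` and `kill(R) ∪ {x_i : i ∈ S}` have the same normal closure.
[cite: ZieschangVogtColdewey1980, 2.2.5] -/
theorem normalClosure_union_of_eq_normalClosure_killHom (S : Set ι) [DecidablePred (· ∈ S)]
    (R : Set (FreeGroup ι)) :
    Subgroup.normalClosure (R ∪ FreeGroup.of '' S) =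
      Subgroup.normalClosure (killHom (· ∈ S) '' R ∪ FreeGroup.of '' S) := by
  have hS1 : Subgroup.normalClosure (FreeGroup.of '' S) ≤ Subgroup.normalClosure (R ∪ FreeGroup.of '' S) :=
    Subgroup.normalClosure_mono Set.subset_union_right
  have hS2 : Subgroup.normalClosure (FreeGroup.of '' S) ≤
      Subgroup.normalClosure (killHom (· ∈ S) '' R ∪ FreeGroup.of '' S) :=
    Subgroup.normalClosure_mono Set.subset_union_right
  apply le_antisymm
  · refine Subgroup.normalClosure_le_normal ?_
    rintro x (hx | hx)
    · have h1 : killHom (· ∈ S) x ∈ Subgroup.normalClosure (killHom (· ∈ S) '' R ∪ FreeGroup.of '' S) :=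
        Subgroup.subset_normalClosure (Or.inl ⟨x, hx, rfl⟩)
      have h2 := hS2 (inv_mul_killHom_mem S x)
      have : x = killHom (· ∈ S) x * (x⁻¹ * killHom (· ∈ S) x)⁻¹ := by group
      rw [this]
      exact mul_mem h1 (inv_mem h2)
    · exact Subgroup.subset_normalClosure (Or.inr hx)
  · refine Subgroup.normalClosure_le_normal ?_
    rintro x (⟨r, hr, rfl⟩ | hx)
    · have h1 : r ∈ Subgroup.normalClosure (R ∪ FreeGroup.of '' S) := Subgroup.subset_normalClosure (Or.inl hr)
      have h2 := hS1 (inv_mul_killHom_mem S r)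
      have : killHom (· ∈ S) r = r * (r⁻¹ * killHom (· ∈ S) r) := by group
      rw [this]
      exact mul_mem h1 h2
    · exact Subgroup.subset_normalClosure (Or.inr hx)

/-! ### Restricting a word to the surviving generators -/

/-- The word `W` over the generators outside `S`, when no letter of `W` involves `S`.
[cite: ZieschangVogtColdewey1980, 2.2.5] -/
def restrictWord (S : Set ι) (W : List (ι × Bool)) (hW : ∀ x ∈ W, x.1 ∉ S) : List ({i // i ∉ S} × Bool) :=
  W.attach.map fun x => (⟨x.1.1, hW x.1 x.2⟩, x.1.2)

/-- The inclusion of letters over the surviving generators. [cite: ZieschangVogtColdewey1980, 2.2.5] -/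
def inclLetter (S : Set ι) : {i // i ∉ S} × Bool → ι × Bool := fun l => ((l.1 : ι), l.2)

omit [DecidableEq ι] in
/-- `inclLetter` is injective. [cite: ZieschangVogtColdewey1980, 2.2.5] -/
theorem inclLetter_injective (S : Set ι) : Function.Injective (inclLetter S) := by
  rintro ⟨⟨i, hi⟩, s⟩ ⟨⟨j, hj⟩, t⟩ h
  simp only [inclLetter, Prod.mk.injEq] at h
  obtain ⟨rfl, rfl⟩ := h
  rfl

omit [DecidableEq ι] in
/-- `inclLetter` commutes with partners. [cite: ZieschangVogtColdewey1980, 2.2.5] -/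
theorem inclLetter_bar (S : Set ι) (l : {i // i ∉ S} × Bool) : inclLetter S (bar l) = bar (inclLetter S l) := rfl

omit [DecidableEq ι] in
/-- Forgetting the proofs recovers the word. [cite: ZieschangVogtColdewey1980, 2.2.5] -/
theorem map_inclLetter_restrictWord (S : Set ι) (W : List (ι × Bool)) (hW : ∀ x ∈ W, x.1 ∉ S) :
    (restrictWord S W hW).map (inclLetter S) = W := by
  rw [restrictWord, map_map]
  conv_rhs => rw [← attach_map_subtype_val W]
  rfl

omit [DecidableEq ι] in
/-- Membership in the restricted word. [cite: ZieschangVogtColdewey1980, 2.2.5] -/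
theorem mem_restrictWord_iff (S : Set ι) (W : List (ι × Bool)) (hW : ∀ x ∈ W, x.1 ∉ S)
    (l : {i // i ∉ S} × Bool) : l ∈ restrictWord S W hW ↔ inclLetter S l ∈ W := by
  constructor
  · intro h
    rw [← map_inclLetter_restrictWord S W hW]
    exact mem_map.2 ⟨l, h, rfl⟩
  · intro h
    have : inclLetter S l ∈ (restrictWord S W hW).map (inclLetter S) := by
      rwa [map_inclLetter_restrictWord]
    obtain ⟨l', hl', he⟩ := mem_map.1 this
    rwa [← inclLetter_injective S he]

omit [DecidableEq ι] in
/-- The restricted word is duplicate-free if the word is. [cite: ZieschangVogtColdewey1980, 2.2.5] -/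
theorem nodup_restrictWord (S : Set ι) {W : List (ι × Bool)} (hW : ∀ x ∈ W, x.1 ∉ S) (hd : W.Nodup) :
    (restrictWord S W hW).Nodup := by
  have := map_inclLetter_restrictWord S W hW
  rw [← this] at hd
  exact hd.of_map _

omit [DecidableEq ι] in
/-- The restricted word is closed if the word is. [cite: ZieschangVogtColdewey1980, 2.2.5] -/
theorem closed_restrictWord (S : Set ι) {W : List (ι × Bool)} (hW : ∀ x ∈ W, x.1 ∉ S) (hc : Closed W) :
    Closed (restrictWord S W hW) := by
  intro l hl
  rw [mem_restrictWord_iff] at hl ⊢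
  rw [inclLetter_bar]
  exact hc _ hl

omit [DecidableEq ι] in
/-- The free-group map of the inclusion sends the restricted word to the word.
[cite: ZieschangVogtColdewey1980, 2.2.5] -/
theorem map_val_mk_restrictWord (S : Set ι) (W : List (ι × Bool)) (hW : ∀ x ∈ W, x.1 ∉ S) :
    FreeGroup.map (Subtype.val : {i // i ∉ S} → ι) (FreeGroup.mk (restrictWord S W hW)) = FreeGroup.mk W := by
  rw [FreeGroup.map.mk]
  congr 1
  exact map_inclLetter_restrictWord S W hW

omit [DecidableEq ι] in
/-- The killing map sends the word to the restricted word. [cite: ZieschangVogtColdewey1980, 2.2.5] -/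
theorem lift_kill_mk_eq (S : Set ι) [DecidablePred (· ∈ S)] :
    ∀ (W : List (ι × Bool)) (hW : ∀ x ∈ W, x.1 ∉ S),
      FreeGroup.lift (fun i => if h : i ∈ S then (1 : FreeGroup {i // i ∉ S}) else FreeGroup.of ⟨i, h⟩)
        (FreeGroup.mk W) = FreeGroup.mk (restrictWord S W hW)
  | [], _ => by
    rw [show (FreeGroup.mk ([] : List (ι × Bool))) = 1 from rfl, map_one]; rfl
  | x :: W, hW => by
    have hx : x.1 ∉ S := hW x mem_cons_self
    have hW' : ∀ y ∈ W, y.1 ∉ S := fun y hy => hW y (mem_cons_of_mem _ hy)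
    have e : restrictWord S (x :: W) hW = (⟨x.1, hx⟩, x.2) :: restrictWord S W hW' := by
      simp [restrictWord, attach_cons, map_map]
    rw [mk_cons_eq_sgen_mul, map_mul, lift_kill_mk_eq S W hW', e, mk_cons_eq_sgen_mul]
    congr 1
    obtain ⟨i, _ | _⟩ := x
    · simp only [sgen_false, map_inv, FreeGroup.lift_apply_of]
      simp only at hx
      rw [dif_neg hx]
    · simp only [sgen_true, FreeGroup.lift_apply_of]
      simp [hx]

omit [DecidableEq ι] in
/-- **Killing generators not involved in the word**: `⟨ι ∣ W, (x_i)_{i ∈ S}⟩ ≅ ⟨ι ∖ S ∣ W⟩`.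
[cite: ZieschangVogtColdewey1980, 2.2.5] -/
theorem nonempty_presentedGroup_kill_equiv (S : Set ι) [DecidablePred (· ∈ S)] (W : List (ι × Bool))
    (hW : ∀ x ∈ W, x.1 ∉ S) :
    Nonempty (PresentedGroup ({FreeGroup.mk W} ∪ FreeGroup.of '' S) ≃*
      PresentedGroup ({FreeGroup.mk (restrictWord S W hW)} : Set (FreeGroup {i // i ∉ S}))) := by
  set rels₁ : Set (FreeGroup ι) := {FreeGroup.mk W} ∪ FreeGroup.of '' S with hrels₁
  set rels₂ : Set (FreeGroup {i // i ∉ S}) := {FreeGroup.mk (restrictWord S W hW)} with hrels₂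
  -- Φ : ⟨ι ∖ S ∣ W'⟩ → ⟨ι ∣ W, S⟩
  let fΦ : {i // i ∉ S} → PresentedGroup rels₁ := fun i => PresentedGroup.of (i : ι)
  have hfΦ : FreeGroup.lift fΦ = (PresentedGroup.mk rels₁).comp (FreeGroup.map Subtype.val) :=
    FreeGroup.ext_hom _ _ fun i => by
      rw [FreeGroup.lift_apply_of, MonoidHom.comp_apply, FreeGroup.map.of]; rfl
  have hΦ : ∀ r ∈ rels₂, FreeGroup.lift fΦ r = 1 := by
    intro r hr
    rw [hrels₂, Set.mem_singleton_iff] at hr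
    subst hr
    rw [hfΦ, MonoidHom.comp_apply, map_val_mk_restrictWord, PresentedGroup.mk_eq_one_iff]
    exact Subgroup.subset_normalClosure (Or.inl rfl)
  let Φ : PresentedGroup rels₂ →* PresentedGroup rels₁ := PresentedGroup.toGroup hΦ
  -- Ψ : ⟨ι ∣ W, S⟩ → ⟨ι ∖ S ∣ W'⟩
  let fΨ : ι → PresentedGroup rels₂ := fun i => if h : i ∈ S then 1 else PresentedGroup.of ⟨i, h⟩
  have hfΨ : FreeGroup.lift fΨ = (PresentedGroup.mk rels₂).comp
      (FreeGroup.lift fun i => if h : i ∈ S then (1 : FreeGroup {i // i ∉ S}) else FreeGroup.of ⟨i, h⟩) :=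
    FreeGroup.ext_hom _ _ fun i => by
      by_cases hi : i ∈ S
      · simp [fΨ, hi]
      · simp only [fΨ, hi, FreeGroup.lift_apply_of, MonoidHom.comp_apply, dif_neg, not_false_eq_true]
        rfl
  have hΨ : ∀ r ∈ rels₁, FreeGroup.lift fΨ r = 1 := by
    rintro r (hr | ⟨i, hi, rfl⟩)
    · rw [Set.mem_singleton_iff] at hr
      subst hr
      rw [hfΨ, MonoidHom.comp_apply, lift_kill_mk_eq S W hW, PresentedGroup.mk_eq_one_iff]
      exact Subgroup.subset_normalClosure rfl
    · rw [FreeGroup.lift_apply_of]; simp [fΨ, hi]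
  let Ψ : PresentedGroup rels₁ →* PresentedGroup rels₂ := PresentedGroup.toGroup hΨ
  refine ⟨MonoidHom.toMulEquiv Ψ Φ ?_ ?_⟩
  · refine PresentedGroup.ext fun i => ?_
    rw [MonoidHom.comp_apply, MonoidHom.id_apply, PresentedGroup.toGroup.of]
    by_cases hi : i ∈ S
    · simp only [fΨ, dif_pos hi, map_one]
      rw [eq_comm]
      change PresentedGroup.mk rels₁ (FreeGroup.of i) = 1
      rw [PresentedGroup.mk_eq_one_iff]
      exact Subgroup.subset_normalClosure (Or.inr ⟨i, hi, rfl⟩)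
    · simp only [fΨ, dif_neg hi]
      rw [PresentedGroup.toGroup.of]
  · refine PresentedGroup.ext fun i => ?_
    rw [MonoidHom.comp_apply, MonoidHom.id_apply, PresentedGroup.toGroup.of]
    simp only [fΦ]
    rw [PresentedGroup.toGroup.of]
    simp [fΨ, i.2]

/-! ### Transport of the vertex permutation along an injective relabelling -/

/-- `formPerm` commutes with an injective relabelling of a duplicate-free list.
[cite: ZieschangVogtColdewey1980, 3.1.2] -/
theorem formPerm_map_of_injective {α β : Type*} [DecidableEq α] [DecidableEq β] {f : α → β}
    (hf : Function.Injective f) {l : List α} (hd : l.Nodup) (x : α) :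
    (l.map f).formPerm (f x) = f (l.formPerm x) := by
  by_cases hx : x ∈ l
  · obtain ⟨k, hk, rfl⟩ := getElem_of_mem hx
    have hd' : (l.map f).Nodup := hd.map hf
    have hk' : k < (l.map f).length := by simpa using hk
    rw [show f l[k] = (l.map f)[k] from (getElem_map f).symm, formPerm_apply_getElem _ hd' k hk',
      formPerm_apply_getElem _ hd k hk, getElem_map]
    simp
  · rw [formPerm_apply_of_notMem hx, formPerm_apply_of_notMem]
    intro h
    obtain ⟨y, hy, he⟩ := mem_map.1 h
    exact hx (hf he ▸ hy)

/-- **One-vertex words stay one-vertex under restriction to the surviving generators.**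
[cite: ZieschangVogtColdewey1980, 3.1.2] -/
theorem vertexTransitive_restrictWord [Fintype ι] (S : Set ι) {W : List (ι × Bool)}
    (hW : ∀ x ∈ W, x.1 ∉ S) (hd : W.Nodup) (hV : VertexTransitive W) :
    VertexTransitive (restrictWord S W hW) := by
  set W' := restrictWord S W hW with hW'
  have hd' : W'.Nodup := nodup_restrictWord S hW hd
  have hmap : W'.map (inclLetter S) = W := map_inclLetter_restrictWord S W hW
  have step : ∀ x, inclLetter S (vertexPerm W' x) = vertexPerm W (inclLetter S x) := by
    intro x
    rw [vertexPerm_apply, vertexPerm_apply, ← inclLetter_bar, ← hmap,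
      formPerm_map_of_injective (inclLetter_injective S) hd']
  have steps : ∀ (n : ℕ) x, inclLetter S ((vertexPerm W' ^ n) x) = (vertexPerm W ^ n) (inclLetter S x) := by
    intro n
    induction n with
    | zero => intro x; rfl
    | succ n ih => intro x; rw [pow_succ', Perm.mul_apply, step, ih, pow_succ', Perm.mul_apply]
  intro x hx y hy
  have hx' : inclLetter S x ∈ W := (mem_restrictWord_iff S W hW x).1 hx
  have hy' : inclLetter S y ∈ W := (mem_restrictWord_iff S W hW y).1 hy
  obtain ⟨n, hn⟩ := (hV _ hx' _ hy').exists_nat_pow_eq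
  rw [← steps] at hn
  exact ⟨n, by rw [zpow_natCast]; exact inclLetter_injective S hn⟩

end Literature.GroupTheory.CombinatorialGroupTheory
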